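import Mathlib
import HarnessLib
import Summits.KontsevichZagierPeriods.KontsevichZagierPeriods.Theses.LinRedNormalForm

/-!
# Sketch — crux idea `dihedral-polynomial-primitives` (crux stmt-KontsevichZagierPeriods-3912, DihedralNormalForm)

First checkable statements of the line, over existing declarations only
(`Literature.NumberTheory.Transcendental.KZ.IntegralRep`, `KZ.of`, `KZ.changeOfVariablesRel`, `KZ.relations`).
Dihedral coordinates of `M_{0,5}` in the cubical chart `x = (x₀, x₁) ∈ (0,1)²`
(Brown, Ann. ENS 42 (2009), (2.6)/(2.8)/(2.9); chords 13, 14, 24, 25, 35 of the pentagon):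
`u₁₃ = 1 - x₀x₁`, `u₁₄ = (1 - x₁)/(1 - x₀x₁)`, `u₂₄ = x₀`, `u₂₅ = x₁`, `u₃₅ = (1 - x₀)/(1 - x₀x₁)`,
all with values in `(0,1)` on the open square and continuous on the closed square minus the corner `(1,1)`.
-/

namespace Summit.KontsevichZagierPeriods.KontsevichZagierPeriods.Cruxes.DihedralNormalForm.DihedralPolynomialPrimitives

open Literature.NumberTheory.Transcendental Set

noncomputable section

/-- The five dihedral coordinates of `M_{0,5}` as functions of the cubical chart `x : Fin 2 → ℝ`
(order: chords 13, 14, 24, 25, 35). -/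
def u5 (x : Fin 2 → ℝ) : Fin 5 → ℝ :=
  ![1 - x 0 * x 1, (1 - x 1) / (1 - x 0 * x 1), x 0, x 1, (1 - x 0) / (1 - x 0 * x 1)]

/-- A polynomial in the dihedral coordinates, read in the cubical chart: the class of PRIMITIVES of the
line (bounded on the closed cell because `0 ≤ u_c ≤ 1` there). -/
def polyU (P : MvPolynomial (Fin 5) ℚ) (x : Fin 2 → ℝ) : ℝ :=
  MvPolynomial.aeval (u5 x) P

/-- CALIBRATION (triage-r1 witnesses W1 = W3, Brown's atom `u₂₄·ω_δ`, value `1`): the dihedral chart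
`Φ(x) = (u₁₃, u₃₅) = (1 - x₀x₁, (1 - x₀)/(1 - x₀x₁))` is a rational bijection of the open unit square onto itself
(inverse `(a,b) ↦ (1 - ab, (1 - a)/(1 - ab))`) with `|det Φ'| = x₀/(1 - x₀x₁)`, so the representation
`[□², x₀/(1 - x₀x₁)]`, whose two coordinate Stokes pieces are separately divergent (W3), is ONE
change-of-variables move away from `[□², 1]`. -/
def W3OneMove : Prop :=
  ∀ (r r' : KZ.IntegralRep 2),
    r.domain = {x | ∀ i, x i ∈ Ioo (0 : ℝ) 1} →
    EqOn r.integrand (fun x => x 0 / (1 - x 0 * x 1)) r.domain →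
    r'.domain = {x | ∀ i, x i ∈ Ioo (0 : ℝ) 1} →
    EqOn r'.integrand (fun _ => 1) r'.domain →
    KZ.of r - KZ.of r' ∈ KZ.changeOfVariablesRel

/-- FIRST LEMMA OF THE LINE at `n = 5` (polynomial-primitive Stokes move): for every polynomial `P` in the
five dihedral coordinates, Newton–Leibniz along the last cubical coordinate with the BOUNDED primitive
`F = P(u(x))` relates the band representation `[□², ∂F/∂x₁]` (integrand = a `ℤ[u]`-combination of atoms divided
by `u₁₃ = 1 - x₀x₁`, hence absolutely convergent) to the base representation
`[(0,1), F(x₀,1) - F(x₀,0)]` (bounded integrand); both endpoint values are polynomials in `u₂₄ = x₀` and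
`u₁₃|_{x₁=1} = 1 - x₀` resp. constants (Brown (2.39)), i.e. atoms of `M_{0,4}`. Provable now
(one `KZ.newtonLeibnizRel` instance + null-set bookkeeping for the open/closed fibre). -/
def PolyPrimitiveStokes5 : Prop :=
  ∀ (P : MvPolynomial (Fin 5) ℚ) (r : KZ.IntegralRep 2) (r' : KZ.IntegralRep 1),
    r.domain = {x | ∀ i, x i ∈ Ioo (0 : ℝ) 1} →
    (∀ x ∈ r.domain,
      HasDerivAt (fun s : ℝ => polyU P (Fin.snoc (Fin.init x) s)) (r.integrand x) (x (Fin.last 1))) →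
    r'.domain = {y | ∀ i, y i ∈ Ioo (0 : ℝ) 1} →
    EqOn r'.integrand (fun y => polyU P (Fin.snoc y 1) - polyU P (Fin.snoc y 0)) r'.domain →
    KZ.of r - KZ.of r' ∈ KZ.relations

/-- The line's reduction of the crux at dimension `k = 2` (sanity instance of the Assembly shape): the crux
`DihedralNormalForm` restricted to `k = 2` — stated by specialising the route decl. -/
def DihedralNormalFormTwo : Prop :=
  ∀ (r : KZ.IntegralRep 2) (p : MvPolynomial (Fin 2) ℚ) (a : Fin 2 → Fin 2 → ℕ) (b c : Fin 2 → ℕ),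
    r.domain = {t | (∀ i, 0 < t i) ∧ (∀ i, t i < 1) ∧ StrictAnti t} →
    Set.EqOn r.integrand (fun t => MvPolynomial.aeval t p /
      ((∏ i, t i ^ b i) * (∏ i, (1 - t i) ^ c i) * ∏ i, ∏ j, if i < j then (t i - t j) ^ a i j else 1)) r.domain →
    ∃ m ∈ AddSubgroup.closure {x : KZ.FormalRep | ∃ (w : ℕ) (ε : Fin w → Bool) (q : ℚ) (s : KZ.IntegralRep w),
        s.domain = {t | (∀ i, 0 < t i) ∧ (∀ i, t i < 1) ∧ StrictAnti t} ∧
        Set.EqOn s.integrand (fun t => (q : ℝ) * ∏ i, if ε i then 1 / (1 - t i) else 1 / t i) s.domain ∧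
        x = KZ.of s},
      KZ.of r - m ∈ KZ.relations

/-- The k = 2 instance is literally the route crux specialised (type-checks against the route decl). -/
theorem dihedralNormalFormTwo_of_crux
    (h : Summit.KontsevichZagierPeriods.KontsevichZagierPeriods.Theses.LinRedNormalForm.DihedralNormalForm) :
    DihedralNormalFormTwo :=
  fun r p a b c hd hi => h 2 r p a b c hd hi

end

end Summit.KontsevichZagierPeriods.KontsevichZagierPeriods.Cruxes.DihedralNormalForm.DihedralPolynomialPrimitives
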